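import Summits.Ventures.YMGap.RobustBall.LocalSourceScreeningStarGeometric
import Summits.Ventures.YMGap.RobustBall.LocalScreeningOnBall
import HarnessLib

/-!
# Venture YMGap, track ROBUST-BALL (Y2) — the SCREENING CURRENCY OF THE STAR DOOR `LocalScreeningOnBallZdG`:
# one screening rate and one constant for every member of the gauge-invariant tier-1 ball, `SU(2)` on `ℤ⁴` up to `β_W = 1/3`

HONEST FRAMING. WHAT THIS IS: a venture file (cell `pub-ymgap`, track Y2 ROBUST-BALL, seat rb-p1): the TYPED CURRENCY of
the star-door screening estimate of `LocalSourceScreeningStar.lean`, in the shape of the track's uniform currencies: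

  `LocalScreeningOnBallZdG d N β ε₀ ε₁ R m A` := for EVERY member `(W, supp)` of ds-2's gauge-invariant tier-1 ball
  `MemBallZdG ε₀ ε₁ R`, EVERY bounded adapted source `V` (locally listed by `suppV`) whose terms read only the links of a
  finite set `S` — ANY size, ANY strength —, every DLR state `μ` of the member at 't Hooft coupling `β`, EVERY DLR state
  `ν` of `W + V` and every Lipschitz cylinder observable `F` (links `Λ`, constant `K_F`):
  `|∫ F dμ − ∫ F dν| ≤ A · e^{−m · d(Λ, S)} · #Λ · K_F`.

Nothing is asserted by the definition.  Bridges (theorems): `localScreeningOnBallZdG_of_robustStar[_variance]` (ds-2's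
robust star door, modulus and variance forms, received sum `≤ ρ₀ < 1`, at the GEOMETRIC rate of this seat's super-solution
comparison: `m = log(1/max(ρ₀,½))/(max R 1 + 4)`, `A = 4√N`); the `SU(2)`, `d = 4` schema on the quarter modulus
`su2_localScreeningOnBallZdG_star` (`A = 4√2`), its linear reading, and its cells on the certificates of `UniformMassGapZdG.lean` /
`MassGapOnBallZdGRows.lean`: `(β_W; ε₀, ε₁) = (1/8; 37/500, 37/1000)` rate `log 2/(max R 1 + 4)`, `(1/8; 37/250, 37/500)` rate
`log(25/13)/…`, `(1/4; 11/200, 11/400)` — PAST THE SINGLE-LINK THRESHOLD `2/9` — rate `log(4/3)/…`, the frontier cells with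
EXPLICIT rates `(1/8, 37/250)`: `1/250`, `(1/4, 11/200)`: `1/300`, ONE `(m, A) = ((1/400)/(max R 1 + 4), 4√2)` for ALL
`0 ≤ β_W ≤ 1/3` on `MemBallZdG (3/125) (3/250) R` (`su2_localScreeningStar_upTo_oneThird`), and the WILSON POINT
(`su2_wilson_localScreeningStar_upTo_oneThird`): for `0 ≤ β_W ≤ 1/3` EVERY bounded local modification of the `SU(2)` Wilson action
on `ℤ⁴` is screened in every DLR state at rate `(1/400)/5`, constant `4√2 · #Λ · K_F`.  Consistency with the single-link currency
of `LocalScreeningOnBall.lean`: `LocalScreeningOnBallZd d N β ε₀ ε₁ R m A ⇒ LocalScreeningOnBallZdG d N β ε₀ ε₁ R m (4A)`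
(`LocalScreeningOnBallZd.localScreeningOnBallZdG`; the G-ball is a sub-ball and `min(B,4) ≤ 4`).
WHAT THIS IS NOT: `m` is a one-sided Dobrushin–Shlosman comparison rate; the constant is strength-free (no linear response
through this door); lattice strong coupling only, nothing about the continuum limit or a Clay-sense mass gap.
-/

noncomputable section

open MeasureTheory Function Finset Real
open scoped NNReal
open Literature.Probability.LatticeModels
open Literature.Probability.LatticeModels.DobrushinMetric (IsLipBound)
open Literature.MathematicalPhysics.QuantumLattice
open Literature.MathematicalPhysics.QuantumFieldTheory hiding ZdEdge Site
open Literature.MathematicalPhysics.QuantumFieldTheory.Balaban1983to89.StrongCouplingDobrushinWindow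
  (OneLinkKRModulus)
open Summit.QuantumFields.BalabanUV.InfraRed.StrongCouplingPoincareDoorSUN (OneLinkPoincareSUN)
open Summit.QuantumFields.BalabanUV.InfraRed.StrongCouplingVarianceDoorSUN (OneLinkVarianceBound)
open Summit.Ventures.YMGap.StarResolventDim (Delta gaugeR doorPoly gaugeR_lt_one_of_door)

namespace Summit.Ventures.YMGap.RobustBall

variable {d N : ℕ}

variable (d N) in
/-- **THE SCREENING CURRENCY OF THE STAR DOOR — local sources are screened uniformly on the gauge-invariant tier-1
`ℤ^d` ball with rate `m` and constant `A`**: for every member `(W, supp)` of `MemBallZdG ε₀ ε₁ R`, every bounded adapted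
source `V` listed by `suppV` whose terms read only the links of the finite set `S`, every DLR state `μ` of the member at
't Hooft coupling `β`, every DLR state `ν` of `W + V` (listed by `supp ∪ suppV`) and every Lipschitz cylinder observable
`F` (`Λ`, `K_F`): `|∫ F dμ − ∫ F dν| ≤ A · e^{−m d(Λ,S)} · #Λ · K_F`.  Nothing is asserted by the definition. -/
def LocalScreeningOnBallZdG (β ε₀ ε₁ : ℝ) (R : ℕ) (m A : ℝ) : Prop :=
  ∀ (W : Potential (ZdEdge d) (SUN N)) (supp : Finset (ZdEdge d) → Finset (Finset (ZdEdge d))),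
    MemBallZdG ε₀ ε₁ R W supp →
  ∀ (V : Potential (ZdEdge d) (SUN N)), V.IsAdapted → (∀ X, ∃ C, ∀ U, |V X U| ≤ C) →
  ∀ (suppV : Finset (ZdEdge d) → Finset (Finset (ZdEdge d))), V.IsSupportedBy suppV →
  ∀ (S : Finset (ZdEdge d)), (∀ X, DependsOn (V X) (↑S : Set (ZdEdge d))) →
  ∀ μ ∈ perturbedGibbsMeasures (d := d) (fundamentalRep (Fin N)) (N * β) W supp,
  ∀ ν ∈ perturbedGibbsMeasures (d := d) (fundamentalRep (Fin N)) (N * β) (W + V) (fun Λ => supp Λ ∪ suppV Λ),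
  ∀ (F : LGConfig d (SUN N) → ℝ) (Λ : Finset (ZdEdge d)) (KF : ℝ≥0),
    IsLipschitzCylinder (fundamentalRep (Fin N)) F Λ KF →
      |(∫ σ, F σ ∂μ) - ∫ σ, F σ ∂ν| ≤ A * exp (-m * setDistEdges Λ S) * (Λ.card * KF)

/-- **Monotonicity**: smaller radii and range, a smaller rate and a larger constant are implied. -/
theorem LocalScreeningOnBallZdG.mono {β ε₀ ε₁ ε₀' ε₁' m A m' A' : ℝ} {R R' : ℕ}
    (h : LocalScreeningOnBallZdG d N β ε₀ ε₁ R m A) (h₀ : ε₀' ≤ ε₀) (h₁ : ε₁' ≤ ε₁) (hR : R' ≤ R)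
    (hm : m' ≤ m) (hA : A ≤ A') (hA0 : 0 ≤ A) : LocalScreeningOnBallZdG d N β ε₀' ε₁' R' m' A' := by
  intro W supp hW V hV hVb suppV hsuppV S hVS μ hμ ν hν F Λ KF hF
  obtain ⟨osc, lip, hosc, hlip, hε₀, hε₁⟩ := hW.loads
  have hW' : MemBallZdG ε₀ ε₁ R W supp := ⟨hW.continuous, hW.dependsOn, hW.supportedBy,
    fun e X hX heX y hy => (hW.range e X hX heX y hy).trans (by exact_mod_cast hR), hW.gaugeInvariant, osc, lip,
    hosc, hlip, fun e => (hε₀ e).trans h₀, fun v => (hε₁ v).trans h₁⟩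
  have key := h W supp hW' V hV hVb suppV hsuppV S hVS μ hμ ν hν F Λ KF hF
  refine key.trans ?_
  have hexp : exp (-m * setDistEdges Λ S) ≤ exp (-m' * setDistEdges Λ S) :=
    exp_le_exp.2 (by nlinarith [setDistEdges_nonneg Λ S])
  have hΛK : (0 : ℝ) ≤ Λ.card * KF := by positivity
  have hA'0 : 0 ≤ A' := hA0.trans hA
  gcongr

/-- **The global reading (STATE-STABILITY shape)**: dropping the distance (`m ≥ 0`), the state moves by at most
`A · #Λ · K_F` under ANY bounded local modification of the action. -/
theorem LocalScreeningOnBallZdG.stateStability {β ε₀ ε₁ m A : ℝ} {R : ℕ} (h : LocalScreeningOnBallZdG d N β ε₀ ε₁ R m A)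
    (hm : 0 ≤ m) (hA0 : 0 ≤ A)
    {W : Potential (ZdEdge d) (SUN N)} {supp : Finset (ZdEdge d) → Finset (Finset (ZdEdge d))}
    (hW : MemBallZdG ε₀ ε₁ R W supp)
    {V : Potential (ZdEdge d) (SUN N)} (hV : V.IsAdapted) (hVb : ∀ X, ∃ C, ∀ U, |V X U| ≤ C)
    {suppV : Finset (ZdEdge d) → Finset (Finset (ZdEdge d))} (hsuppV : V.IsSupportedBy suppV)
    {S : Finset (ZdEdge d)} (hVS : ∀ X, DependsOn (V X) (↑S : Set (ZdEdge d)))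
    {μ ν : Measure (LGConfig d (SUN N))}
    (hμ : μ ∈ perturbedGibbsMeasures (d := d) (fundamentalRep (Fin N)) (N * β) W supp)
    (hν : ν ∈ perturbedGibbsMeasures (d := d) (fundamentalRep (Fin N)) (N * β) (W + V)
      (fun Λ => supp Λ ∪ suppV Λ))
    {F : LGConfig d (SUN N) → ℝ} {Λ : Finset (ZdEdge d)} {KF : ℝ≥0}
    (hF : IsLipschitzCylinder (fundamentalRep (Fin N)) F Λ KF) :
    |(∫ σ, F σ ∂μ) - ∫ σ, F σ ∂ν| ≤ A * (Λ.card * KF) := by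
  have key := h W supp hW V hV hVb suppV hsuppV S hVS μ hμ ν hν F Λ KF hF
  refine key.trans ?_
  have hexp : exp (-m * setDistEdges Λ S) ≤ 1 := exp_le_one_iff.2 (by nlinarith [setDistEdges_nonneg Λ S])
  have hΛK : (0 : ℝ) ≤ Λ.card * KF := by positivity
  calc A * exp (-m * setDistEdges Λ S) * (Λ.card * KF) ≤ A * 1 * (Λ.card * KF) := by gcongr
    _ = A * (Λ.card * KF) := by ring

/-! ### Consistency with the single-link currency -/

/-- **The single-link screening currency implies the star currency with constant `4A`** on the gauge-invariant ball
of the same radii: `MemBallZdG` is a sub-ball of `MemBallZd` (`MemBallZdG.memBallZd`), a source reading only `S` has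
oscillation witnesses vanishing off `S` (`2 sup|V_X|` on `S`), and `min(B,4) ≤ 4`. -/
theorem LocalScreeningOnBallZd.localScreeningOnBallZdG {β ε₀ ε₁ m A : ℝ} {R : ℕ}
    (h : LocalScreeningOnBallZd d N β ε₀ ε₁ R m A) (hA0 : 0 ≤ A) :
    LocalScreeningOnBallZdG d N β ε₀ ε₁ R m (4 * A) := by
  classical
  intro W supp hW V hV hVb suppV hsuppV S hVS μ hμ ν hν F Λ KF hF
  -- oscillation witnesses of the source: `2 C_X` on `S`, `0` off `S`
  choose C hC using hVb
  have hC0 : ∀ X, 0 ≤ C X := fun X => (abs_nonneg _).trans (hC X 1)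
  set oscV : Finset (ZdEdge d) → ZdEdge d → ℝ := fun X e => if e ∈ S then 2 * C X else 0 with hoscV_def
  have hoscV : ∀ X, Dobrushin.IsOscBound (V X) (oscV X) := fun X =>
    (Dobrushin.IsOscBound.of_abs_le (hC0 X) (hC X)).restrict (hVS X)
  set B : ℝ := ∑ e ∈ S, ∑ X ∈ (suppV {e}).filter (fun X => e ∈ X), oscV X e with hB_def
  have hterm0 : ∀ e X, 0 ≤ oscV X e := fun e X => (hoscV X).nonneg e
  have hB0 : 0 ≤ B := Finset.sum_nonneg fun e _ => Finset.sum_nonneg fun X _ => hterm0 e X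
  have hoff : ∀ e, e ∉ S → ∑ X ∈ (suppV {e}).filter (fun X => e ∈ X), oscV X e ≤ 0 := fun e he =>
    (Finset.sum_eq_zero fun X _ => by simp [hoscV_def, he]).le
  have hB : ∀ e, ∑ X ∈ (suppV {e}).filter (fun X => e ∈ X), oscV X e ≤ B := fun e => by
    by_cases he : e ∈ S
    · exact Finset.single_le_sum (f := fun e => ∑ X ∈ (suppV {e}).filter (fun X => e ∈ X), oscV X e)
        (fun e _ => Finset.sum_nonneg fun X _ => hterm0 e X) he
    · exact (hoff e he).trans hB0
  have key := h W supp hW.memBallZd V hV (fun X => ⟨C X, hC X⟩) suppV hsuppV oscV hoscV B S hB hoff μ hμ ν hν F Λ KF hF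
  refine key.trans ?_
  have hmin : min B 4 ≤ 4 := min_le_right _ _
  have hmin0 : 0 ≤ min B 4 := le_min hB0 (by norm_num)
  have hΛK : (0 : ℝ) ≤ Λ.card * KF := by positivity
  have hexp : 0 ≤ exp (-m * setDistEdges Λ S) := (exp_pos _).le
  calc A * min B 4 * exp (-m * setDistEdges Λ S) * (Λ.card * KF)
      ≤ A * 4 * exp (-m * setDistEdges Λ S) * (Λ.card * KF) := by gcongr
    _ = 4 * A * exp (-m * setDistEdges Λ S) * (Λ.card * KF) := by ring

/-! ### The bridge: ds-2's robust star door (geometric rate), modulus and variance forms -/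

/-- **The star screening currency from the robust star door** (hypotheses of `uniformMassGapOnBallZdG_of_robustStar`,
`ρ ≤ ρ₀ < 1`): `LocalScreeningOnBallZdG d N β ε₀ ε₁ R (log(1/max(ρ₀,½))/(max R 1 + 4)) (4√N)`. -/
theorem localScreeningOnBallZdG_of_robustStar (hd : 2 ≤ d) (hN : 1 ≤ N) {β ε₀ ε₁ Rm K c lam θ ρ ρ₀ : ℝ}
    {R Kn : ℕ} (hK : 0 ≤ K) (hRm : |(N : ℝ) * β| / N * (2 * ((d : ℝ) - 1)) ≤ Rm) (hmod : OneLinkKRModulus N Rm K)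
    (hε₁ : 0 ≤ ε₁) (hc : K * Real.exp ε₀ * (1 + 2 * Real.sqrt N * ε₁) * (|(N : ℝ) * β| / N) ≤ c)
    (hlam : Real.sqrt N * ε₁ ≤ lam) (hθ : θ = (2 * (d : ℝ) - 2) * c + lam) (hθ1 : θ < 1)
    (hcd : doorPoly d c < 1) (hρ : ρ = gaugeR d c + (lam + θ ^ Kn * (4 * d * lam)) / (1 - θ)) (hρle : ρ ≤ ρ₀)
    (hρ1 : ρ₀ < 1) :
    LocalScreeningOnBallZdG d N β ε₀ ε₁ R (-Real.log (max ρ₀ (1 / 2)) / (max R 1 + 4 : ℕ)) (4 * Real.sqrt N) := by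
  intro W supp hW V hV hVb suppV hsuppV S hVS μ hμ ν hν F Λ KF hF
  have key := localScreeningStar_of_memBallZdG_geometric hd hN hK hRm hmod hε₁ hc hlam hθ hθ1 hcd hρ hρle hρ1 hW hV hVb
    hsuppV hVS hμ hν hF
  simpa only [neg_mul] using key

/-- **The star screening currency from the VARIANCE-FORM robust star door** (hypotheses of ds-2's
`massGapOnBallZdG_of_robustStar_variance`: a one-link Poincaré/variance pair `(c_P, v)`; `ρ ≤ ρ₀ < 1`):
`LocalScreeningOnBallZdG d N β ε₀ ε₁ R (log(1/max(ρ₀,½))/(max R 1 + 4)) (4√N)`. -/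
theorem localScreeningOnBallZdG_of_robustStar_variance (hd : 2 ≤ d) (hN : 1 ≤ N) {β ε₀ ε₁ b cP v c lam θ ρ ρ₀ : ℝ}
    {R Kn : ℕ} (hcP : 0 ≤ cP) (hv : 0 ≤ v) (hb : |(N : ℝ) * β| / N * (2 * ((d : ℝ) - 1)) ≤ b) (hP : OneLinkPoincareSUN N b cP)
    (hVB : OneLinkVarianceBound N b v) (hε₁ : 0 ≤ ε₁) (hc : Real.exp ε₀ * Real.sqrt (cP * v) * (|(N : ℝ) * β| / N) ≤ c)
    (hlam : Real.exp (ε₀ / 2) * Real.sqrt cP * ε₁ ≤ lam) (hθ : θ = (2 * (d : ℝ) - 2) * c + lam) (hθ1 : θ < 1)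
    (hcd : doorPoly d c < 1) (hρ : ρ = gaugeR d c + (lam + θ ^ Kn * (4 * d * lam)) / (1 - θ)) (hρle : ρ ≤ ρ₀)
    (hρ1 : ρ₀ < 1) :
    LocalScreeningOnBallZdG d N β ε₀ ε₁ R (-Real.log (max ρ₀ (1 / 2)) / (max R 1 + 4 : ℕ)) (4 * Real.sqrt N) := by
  intro W supp hW V hV hVb suppV hsuppV S hVS μ hμ ν hν F Λ KF hF
  have key := localScreeningStar_of_memBallZdG_variance_geometric hd hN hcP hv hb hP hVB hε₁ hc hlam hθ hθ1 hcd hρ hρle hρ1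
    hW hV hVb hsuppV hVS hμ hν hF
  simpa only [neg_mul] using key

/-! ### `SU(2)`, `d = 4`: the schema on the quarter modulus and cells with a legible rate -/

/-- **SCHEMA, `SU(2)`, `d = 4`** (the hypotheses of `su2_uniformMassGapOnBallZdG_star`): decimal majorants `e^{ε₀} ≤ E`,
`√2 ≤ S`, a coefficient `c ≥ E(1 + 2Sε₁)β_W/4`, `λ ≥ Sε₁`, the rational inequalities `doorPoly 4 c < 1`, `6c + λ < 1`,
`gaugeR 4 c + (λ + (6c+λ)^Kn·16λ)/(1 − (6c+λ)) ≤ ρ₀ < 1` ⇒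
`LocalScreeningOnBallZdG 4 2 (β_W/4) ε₀ ε₁ R (log(1/max(ρ₀,½))/(max R 1 + 4)) (4√2)`. -/
theorem su2_localScreeningOnBallZdG_star (Kn : ℕ) {βW ε₀ ε₁ c lam E S ρ₀ : ℝ} (hβ0 : 0 ≤ βW) (hβ : βW ≤ 2 / 3)
    (hε₁ : 0 ≤ ε₁) (hE : Real.exp ε₀ ≤ E) (hS : Real.sqrt 2 ≤ S) (hc : E * (1 + 2 * S * ε₁) * (βW / 4) ≤ c)
    (hlam : S * ε₁ ≤ lam) (hθ1 : 6 * c + lam < 1) (hcd : doorPoly 4 c < 1)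
    (hρ0 : gaugeR 4 c + (lam + (6 * c + lam) ^ Kn * (16 * lam)) / (1 - (6 * c + lam)) ≤ ρ₀) (hρ1 : ρ₀ < 1)
    (R : ℕ) :
    LocalScreeningOnBallZdG 4 2 (βW / 4) ε₀ ε₁ R (-Real.log (max ρ₀ (1 / 2)) / (max R 1 + 4 : ℕ)) (4 * Real.sqrt 2) := by
  have hS0 : 0 ≤ S := (Real.sqrt_nonneg _).trans hS
  have hE0 : 0 ≤ E := (Real.exp_pos _).le.trans hE
  set θ : ℝ := 6 * c + lam with hθ
  set ρ : ℝ := gaugeR 4 c + (lam + θ ^ Kn * (16 * lam)) / (1 - θ) with hρ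
  have habs : |((2 : ℕ) : ℝ) * (βW / 4)| / ((2 : ℕ) : ℝ) = βW / 4 := by
    rw [abs_of_nonneg (by positivity)]
    push_cast
    ring
  have hR : |((2 : ℕ) : ℝ) * (βW / 4)| / ((2 : ℕ) : ℝ) * (2 * (((4 : ℕ) : ℝ) - 1)) ≤ 3 * βW / 2 := by
    rw [habs]; push_cast; linarith
  have hc' : (1 : ℝ) * Real.exp ε₀ * (1 + 2 * Real.sqrt ((2 : ℕ) : ℝ) * ε₁) *
      (|((2 : ℕ) : ℝ) * (βW / 4)| / ((2 : ℕ) : ℝ)) ≤ c := by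
    refine le_trans ?_ hc
    have h1 : Real.sqrt ((2 : ℕ) : ℝ) = Real.sqrt 2 := by norm_num
    rw [h1, one_mul, habs]
    have hb : 0 ≤ βW / 4 := by positivity
    calc Real.exp ε₀ * (1 + 2 * Real.sqrt 2 * ε₁) * (βW / 4) ≤ E * (1 + 2 * Real.sqrt 2 * ε₁) * (βW / 4) := by
          gcongr
      _ ≤ E * (1 + 2 * S * ε₁) * (βW / 4) := by gcongr
  have hlam' : Real.sqrt ((2 : ℕ) : ℝ) * ε₁ ≤ lam := by
    have h1 : Real.sqrt ((2 : ℕ) : ℝ) = Real.sqrt 2 := by norm_num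
    rw [h1]; exact le_trans (mul_le_mul_of_nonneg_right hS hε₁) hlam
  have hθ' : θ = (2 * ((4 : ℕ) : ℝ) - 2) * c + lam := by rw [hθ]; push_cast; ring
  have hρ' : ρ = gaugeR 4 c + (lam + θ ^ Kn * (4 * ((4 : ℕ) : ℝ) * lam)) / (1 - θ) := by rw [hρ]; push_cast; ring
  have h4 : (4 * Real.sqrt ((2 : ℕ) : ℝ) : ℝ) = 4 * Real.sqrt 2 := by norm_num
  rw [← h4]
  exact localScreeningOnBallZdG_of_robustStar (d := 4) (N := 2) (by norm_num) (by norm_num) zero_le_one hR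
    (su2_quarterModulus hβ) hε₁ hc' hlam' hθ' hθ1 hcd hρ' hρ0 hρ1

/-- **LINEAR READING** (`1/2 ≤ ρ₀`): `LocalScreeningOnBallZdG 4 2 (β_W/4) ε₀ ε₁ R ((1 − ρ₀)/(max R 1 + 4)) (4√2)`
(`log(1/ρ₀) ≥ 1 − ρ₀`). -/
theorem su2_localScreeningOnBallZdG_star_linear (Kn : ℕ) {βW ε₀ ε₁ c lam E S ρ₀ : ℝ} (hβ0 : 0 ≤ βW) (hβ : βW ≤ 2 / 3)
    (hε₁ : 0 ≤ ε₁) (hE : Real.exp ε₀ ≤ E) (hS : Real.sqrt 2 ≤ S) (hc : E * (1 + 2 * S * ε₁) * (βW / 4) ≤ c)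
    (hlam : S * ε₁ ≤ lam) (hθ1 : 6 * c + lam < 1) (hcd : doorPoly 4 c < 1)
    (hρ0 : gaugeR 4 c + (lam + (6 * c + lam) ^ Kn * (16 * lam)) / (1 - (6 * c + lam)) ≤ ρ₀) (hhalf : 1 / 2 ≤ ρ₀)
    (hρ1 : ρ₀ < 1) (R : ℕ) :
    LocalScreeningOnBallZdG 4 2 (βW / 4) ε₀ ε₁ R ((1 - ρ₀) / (max R 1 + 4 : ℕ)) (4 * Real.sqrt 2) := by
  have h := su2_localScreeningOnBallZdG_star Kn hβ0 hβ hε₁ hE hS hc hlam hθ1 hcd hρ0 hρ1 R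
  have hD : (0 : ℝ) < ((max R 1 + 4 : ℕ) : ℝ) := by positivity
  have hmax : max ρ₀ (1 / 2) = ρ₀ := max_eq_left hhalf
  have hrate : 1 - ρ₀ ≤ -Real.log (max ρ₀ (1 / 2)) := by
    rw [hmax]; have := Real.log_le_sub_one_of_pos (show (0 : ℝ) < ρ₀ by linarith); linarith
  exact h.mono le_rfl le_rfl le_rfl (div_le_div_of_nonneg_right hrate hD.le) le_rfl (by positivity)

/-- **CELL `β_W = 1/8`, QUARTER RADIUS `(ε₀, ε₁) = (37/500, 37/1000)`**: received sum `≤ 7/20 ≤ 1/2` ⇒ for EVERY member of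
`MemBallZdG (37/500) (37/1000) R` at 't Hooft `1/32`, every local source of any strength and every DLR pair: screening at
rate `log 2/(max R 1 + 4)` with constant `4√2 · #Λ · K_F` (certificate `c = 9293/250000`, `λ = 52327/1000000`, `E = T₄(37/500)`). -/
theorem su2_localScreeningStar_oneEighth_quarterRadius (R : ℕ) :
    LocalScreeningOnBallZdG 4 2 (1 / 32) (37 / 500) (37 / 1000) R (Real.log 2 / (max R 1 + 4 : ℕ)) (4 * Real.sqrt 2) := by
  have e1 : (1 / 8 : ℝ) / 4 = 1 / 32 := by norm_num
  have h := su2_localScreeningOnBallZdG_star 20 (βW := 1 / 8) (ε₀ := 37 / 500) (ε₁ := 37 / 1000)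
    (c := 9293 / 250000) (lam := 52327 / 1000000) (ρ₀ := 7 / 20) (by norm_num) (by norm_num) (by norm_num)
    (exp_le_taylor4 (x := 37 / 500) (by norm_num) (by norm_num)) sqrt_two_le (by norm_num) (by norm_num)
    (by norm_num) (by unfold doorPoly; norm_num) (by unfold gaugeR Delta; norm_num) (by norm_num) R
  rw [e1] at h
  have hlog : -Real.log (max (7 / 20 : ℝ) (1 / 2)) = Real.log 2 := by
    rw [show max (7 / 20 : ℝ) (1 / 2) = 1 / 2 by norm_num, one_div, Real.log_inv, neg_neg]
  rw [hlog] at h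
  exact h

/-- **CELL `β_W = 1/8`, HALF RADIUS `(ε₀, ε₁) = (37/250, 37/500)`**: received sum `≤ 13/25` ⇒ rate `log(25/13)/(max R 1 + 4)`
(`≈ 0.654/…`), constant `4√2 · #Λ · K_F` (certificate `c = 2191/50000`, `λ = 104653/1000000`). -/
theorem su2_localScreeningStar_oneEighth_halfRadius (R : ℕ) :
    LocalScreeningOnBallZdG 4 2 (1 / 32) (37 / 250) (37 / 500) R (Real.log (25 / 13) / (max R 1 + 4 : ℕ))
      (4 * Real.sqrt 2) := by
  have e1 : (1 / 8 : ℝ) / 4 = 1 / 32 := by norm_num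
  have h := su2_localScreeningOnBallZdG_star 20 (βW := 1 / 8) (ε₀ := 37 / 250) (ε₁ := 37 / 500)
    (c := 2191 / 50000) (lam := 104653 / 1000000) (ρ₀ := 13 / 25) (by norm_num) (by norm_num) (by norm_num)
    (exp_le_taylor4 (x := 37 / 250) (by norm_num) (by norm_num)) sqrt_two_le (by norm_num) (by norm_num)
    (by norm_num) (by unfold doorPoly; norm_num) (by unfold gaugeR Delta; norm_num) (by norm_num) R
  rw [e1] at h
  have hlog : -Real.log (max (13 / 25 : ℝ) (1 / 2)) = Real.log (25 / 13) := by
    rw [show max (13 / 25 : ℝ) (1 / 2) = 13 / 25 by norm_num, ← Real.log_inv]; norm_num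
  rw [hlog] at h
  exact h

/-- **CELL `β_W = 1/4`, HALF RADIUS `(ε₀, ε₁) = (11/200, 11/400)` — BEYOND THE SINGLE-LINK THRESHOLD `2/9`** (no
single-link screening row exists here): received sum `≤ 3/4` ⇒ rate `log(4/3)/(max R 1 + 4)` (`≈ 0.288/…`), constant
`4√2 · #Λ · K_F` (certificate `c = 71171/1000000`, `λ = 9723/250000`). -/
theorem su2_localScreeningStar_oneQuarter_halfRadius (R : ℕ) :
    LocalScreeningOnBallZdG 4 2 (1 / 16) (11 / 200) (11 / 400) R (Real.log (4 / 3) / (max R 1 + 4 : ℕ))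
      (4 * Real.sqrt 2) := by
  have e1 : (1 / 4 : ℝ) / 4 = 1 / 16 := by norm_num
  have h := su2_localScreeningOnBallZdG_star 20 (βW := 1 / 4) (ε₀ := 11 / 200) (ε₁ := 11 / 400)
    (c := 71171 / 1000000) (lam := 9723 / 250000) (ρ₀ := 3 / 4) (by norm_num) (by norm_num) (by norm_num)
    (exp_le_taylor4 (x := 11 / 200) (by norm_num) (by norm_num)) sqrt_two_le (by norm_num) (by norm_num)
    (by norm_num) (by unfold doorPoly; norm_num) (by unfold gaugeR Delta; norm_num) (by norm_num) R
  rw [e1] at h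
  have hlog : -Real.log (max (3 / 4 : ℝ) (1 / 2)) = Real.log (4 / 3) := by
    rw [show max (3 / 4 : ℝ) (1 / 2) = 3 / 4 by norm_num, ← Real.log_inv]; norm_num
  rw [hlog] at h
  exact h

/-! ### The frontier cells, with EXPLICIT rates -/

/-- **FRONTIER CELL `(β_W, ε) = (1/8, 37/250)`**: received sum `≤ 249/250` ⇒ rate `(1/250)/(max R 1 + 4)`, constant `4√2`. -/
theorem su2_localScreeningStar_frontier_oneEighth (R : ℕ) :
    LocalScreeningOnBallZdG 4 2 (1 / 32) (37 / 125) (37 / 250) R ((1 / 250 : ℝ) / (max R 1 + 4 : ℕ)) (4 * Real.sqrt 2) := by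
  have e1 : (1 / 8 : ℝ) / 4 = 1 / 32 := by norm_num
  have e2 : (1 : ℝ) - 249 / 250 = 1 / 250 := by norm_num
  have h := su2_localScreeningOnBallZdG_star_linear 20 (βW := 1 / 8) (ε₀ := 37 / 125) (ε₁ := 37 / 250)
    (c := 59603 / 1000000) (lam := 41861 / 200000) (ρ₀ := 249 / 250) (by norm_num) (by norm_num) (by norm_num)
    exp_le_37_125_star sqrt_two_le (by norm_num) (by norm_num) (by norm_num) (by unfold doorPoly; norm_num)
    (by unfold gaugeR Delta; norm_num) (by norm_num) (by norm_num) R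
  rw [e1, e2] at h
  exact h

/-- **FRONTIER CELL `(β_W, ε) = (1/4, 11/200)`**: received sum `≤ 299/300` ⇒ rate `(1/300)/(max R 1 + 4)`, constant `4√2`. -/
theorem su2_localScreeningStar_frontier_oneQuarter (R : ℕ) :
    LocalScreeningOnBallZdG 4 2 (1 / 16) (11 / 100) (11 / 200) R ((1 / 300 : ℝ) / (max R 1 + 4 : ℕ)) (4 * Real.sqrt 2) := by
  have e1 : (1 / 4 : ℝ) / 4 = 1 / 16 := by norm_num
  have e2 : (1 : ℝ) - 299 / 300 = 1 / 300 := by norm_num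
  have h := su2_localScreeningOnBallZdG_star_linear 20 (βW := 1 / 4) (ε₀ := 11 / 100) (ε₁ := 11 / 200)
    (c := 80621 / 1000000) (lam := 77783 / 1000000) (ρ₀ := 299 / 300) (by norm_num) (by norm_num) (by norm_num)
    exp_le_11_100_star sqrt_two_le (by norm_num) (by norm_num) (by norm_num) (by unfold doorPoly; norm_num)
    (by unfold gaugeR Delta; norm_num) (by norm_num) (by norm_num) R
  rw [e1, e2] at h
  exact h

/-- **UP TO `β_W = 1/3`, ONE EXPLICIT `(m, A) = ((1/400)/(max R 1 + 4), 4√2)`** for every `0 ≤ β_W ≤ 1/3`, every member of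
`MemBallZdG (3/125) (3/250) R`, every local source and every DLR pair (received sum `≤ 399/400` along the segment). -/
theorem su2_localScreeningStar_upTo_oneThird {βW : ℝ} (h0 : 0 ≤ βW) (h : βW ≤ 1 / 3) (R : ℕ) :
    LocalScreeningOnBallZdG 4 2 (βW / 4) (3 / 125) (3 / 250) R ((1 / 400 : ℝ) / (max R 1 + 4 : ℕ)) (4 * Real.sqrt 2) := by
  have e2 : (1 : ℝ) - 399 / 400 = 1 / 400 := by norm_num
  rw [← e2]
  refine su2_localScreeningOnBallZdG_star_linear 20 (ε₀ := 3 / 125) (ε₁ := 3 / 250) (c := 17651 / 200000)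
    (lam := 16971 / 1000000) (E := 1024291 / 1000000) (S := 1.41422) (ρ₀ := 399 / 400) h0 (h.trans (by norm_num))
    (by norm_num) exp_le_3_125_star sqrt_two_le ?_ (by norm_num) (by norm_num) (by unfold doorPoly; norm_num)
    (by unfold gaugeR Delta; norm_num) (by norm_num) (by norm_num) R
  calc (1024291 / 1000000 : ℝ) * (1 + 2 * 1.41422 * (3 / 250)) * (βW / 4)
      ≤ 1024291 / 1000000 * (1 + 2 * 1.41422 * (3 / 250)) * ((1 / 3) / 4) := by gcongr
    _ ≤ 17651 / 200000 := by norm_num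

/-! ### The Wilson point up to `β_W = 1/3` -/

/-- **THE WILSON POINT, `SU(2)` ON `ℤ⁴`, EVERY `0 ≤ β_W ≤ 1/3`: every bounded LOCAL MODIFICATION of the Wilson action is
screened, EXPLICITLY.** For every `0 ≤ β_W ≤ 1/3`, every bounded adapted link potential `V` (listed by `suppV`) whose terms read
only the links of a finite set `S` — Wilson-loop insertions of any size and strength, couplings changed on finitely many plaquettes,
… —, every DLR state `μ` of `SU(2)` lattice Yang–Mills at `β_W` (tree coupling `β_W/2`), EVERY DLR state `ν` of the modified action
and every Lipschitz cylinder `F`: `|∫ F dμ − ∫ F dν| ≤ 4√2 · e^{−((1/400)/5) d(Λ_F, S)} · #Λ_F · K_F` (the zero member of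
`MemBallZdG (3/125) (3/250) 0`). -/
theorem su2_wilson_localScreeningStar_upTo_oneThird {βW : ℝ} (h0 : 0 ≤ βW) (h1 : βW ≤ 1 / 3)
    {V : Potential (ZdEdge 4) (SUN 2)} (hV : V.IsAdapted) (hVb : ∀ X, ∃ C, ∀ U, |V X U| ≤ C)
    {suppV : Finset (ZdEdge 4) → Finset (Finset (ZdEdge 4))} (hsuppV : V.IsSupportedBy suppV)
    {S : Finset (ZdEdge 4)} (hVS : ∀ X, DependsOn (V X) (↑S : Set (ZdEdge 4)))
    {μ ν : Measure (LGConfig 4 (SUN 2))}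
    (hμ : μ ∈ ymGibbsMeasures (d := 4) (fundamentalRep (Fin 2)) (2 * (βW / 4)))
    (hν : ν ∈ perturbedGibbsMeasures (d := 4) (fundamentalRep (Fin 2)) (2 * (βW / 4)) V suppV)
    {F : LGConfig 4 (SUN 2) → ℝ} {Λ : Finset (ZdEdge 4)} {KF : ℝ≥0}
    (hF : IsLipschitzCylinder (fundamentalRep (Fin 2)) F Λ KF) :
    |(∫ σ, F σ ∂μ) - ∫ σ, F σ ∂ν| ≤
      4 * Real.sqrt 2 * exp (-((1 / 400 : ℝ) / 5) * setDistEdges Λ S) * (Λ.card * KF) := by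
  have hball := su2_localScreeningStar_upTo_oneThird h0 h1 0
  have e5 : ((max 0 1 + 4 : ℕ) : ℝ) = 5 := by norm_num
  rw [e5] at hball
  have hmem : MemBallZdG (N := 2) (d := 4) (3 / 125) (3 / 250) 0 0 (fun _ => (∅ : Finset (Finset (ZdEdge 4)))) :=
    memBallZdG_zero (by norm_num) (by norm_num) 0
  have hμ' : μ ∈ perturbedGibbsMeasures (d := 4) (fundamentalRep (Fin 2)) ((2 : ℕ) * (βW / 4))
      (0 : Potential (ZdEdge 4) (SUN 2)) (fun _ => ∅) := by
    rw [perturbedGibbsMeasures_zero]; exact_mod_cast hμ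
  have hν' : ν ∈ perturbedGibbsMeasures (d := 4) (fundamentalRep (Fin 2)) ((2 : ℕ) * (βW / 4))
      ((0 : Potential (ZdEdge 4) (SUN 2)) + V)
      (fun Λ => (fun _ : Finset (ZdEdge 4) => (∅ : Finset (Finset (ZdEdge 4)))) Λ ∪ suppV Λ) := by
    simpa only [zero_add, Finset.empty_union, Nat.cast_ofNat] using hν
  exact hball 0 _ hmem V hV hVb suppV hsuppV S hVS μ hμ' ν hν' F Λ KF hF

end Summit.Ventures.YMGap.RobustBall

end
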